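import Summits.ABC.IUTFork.Cor312SoundInput
import Summits.ABC.IUTFork.Cor312TeamAGapWitnessB
import HarnessLib

/-!
# [IUTchIII] Cor. 3.12 — GapA (`SoundAtInput`) is STRICTLY STRONGER than the typed Corollary: a two-object setting

Record-only file (D-0012) of the abc-iut cell (WAVE-5 prover seat abc-iut-w5-d236; companion of
`Cor312SoundInputWitness`, evidence for `HOME/plan/ADJUDICATION-SPEC.md` §4 (ii)/(iii) on Team A's gap
statement of record `Cor312Vol.SoundAtInput` of `Cor312SoundInput.lean`); TAKES NO SIDE.

Over Team A's typed-Theorem-3.11 situation `GapWitness.gapFull` (same toy carriers: `l⋇ = 2`, one place,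
nontrivial `ℚ`-packets, hull frame `{{0}, univ}`, log-volume `−2` inside `{0}` and `−1` outside) we build
the verbatim setting `twoSetting` whose Frobenioids `†𝒞^⊩_lgp`, `†𝒞^⊩_△` have TWO objects `true` (the
pilots) and `false`: the Θ-side Kummer image of `true` is the whole packet (`−1`), of `false` is `{0}`
(`−2`); the `q`-side image of `true` is `{0}` (`−2`), of `false` is everything (`−1`). Then every bridge
hypothesis and `|log(q)| > 0` hold, the typed Corollary 3.12 HOLDS (strictly, `−2 < −1`), but GapA FAILS
for the identity gluing at the non-pilot input `false` (`twoSetting_not_soundAtInput`). ∃-form: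
`statement_not_imp_soundAtInput`. So the (G) derivation "GapA ⟹ Statement" consumes a hypothesis that
is NOT implied back by its conclusion plus the premises: the universal quantifier over the algorithm's
inputs is genuine extra content as soon as `†𝒞^⊩_lgp` has a second object (at a one-object setting GapA is
the Statement: `soundAtInput_iff_statement_of_subsingleton` in the companion file).

HONEST SCOPE: interface-level only, exactly as Team A's witness; nothing here says anything about the
assembled real setting, and nothing asserts or denies [IUTchIII] Cor. 3.12 or any reading of Step (xi).
[claim: Mochizuki2012, status: disputed] [cite: ScholzeStix2018, §2.2 pp. 9–10]
-/

noncomputable section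

namespace Summit.ABC

namespace IUTFork

namespace Cor312Vol

open Thm311 Cor312 Cor312.Checks Literature.IUT.LogThetaLattice

/-! ## 1. The two-object signature and setting -/

namespace TwoObjectWitness

open GapWitness

/-- A Prop. 3.7 output all of whose Frobenioids have the TWO objects `true`, `false`; the object-forming
algorithm always returns `true` (so the Θ-pilot object is `true`); embeddings `b ↦ (j ↦ b)`. [folklore] -/
def boolSig : GlobalLGPFrobenioidSignature 2 Unit (· ∈ (Set.univ : Set Unit)) Unit (fun _ _ => Unit)
    (fun _ => Bool) id Unit (fun _ _ => Unit) (fun _ _ => Unit) where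
  FMOD := fun _ => ()
  Fmod := fun _ => ()
  Ffrak := fun _ => ()
  isoModMOD := fun _ => ()
  isoModFrak := fun _ => ()
  isoFrakMOD := fun _ => ()
  CLGP := ()
  Clgp := ()
  FLGP := ()
  Flgp := ()
  Fgau := ()
  isoGauLGP := ()
  isoLGPlgp := ()
  isoCLGPlgp := ()
  embLGP := fun b _ => b
  embLgp := fun b _ => b
  embLGP_injective := fun a b h => by simpa using congrFun h 0
  embLgp_injective := fun a b h => by simpa using congrFun h 0
  objOfLgp := fun _ => true
  objOfLGP := fun _ => true
  objOfFrak := fun _ _ => true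
  objOfMOD := fun _ _ => true

/-- The TWO-OBJECT setting over Team A's `gapSituation`: `†𝒞^⊩_lgp` and `†𝒞^⊩_△` both have objects
`true` (the pilots) and `false`; the Θ-side Kummer image of `true` is the whole packet (log-volume `−1`),
of `false` is `{0}` (`−2`); the `q`-side image of `true` is `{0}` (`−2`), of `false` is everything (`−1`).
[folklore] -/
def twoSetting : Cor312.Setting gapSituation where
  n := 0
  HT := ℤ × ℤ
  LogLink := fun _ _ => Unit
  IsFull := fun _ => True
  lattice :=
    { theater := fun n m => (n, m)
      distinct := fun p q h => by simpa using h
      logLink := fun _ _ => ()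
      logLink_full := fun _ _ => trivial }
  Frd := Unit
  IsoF := fun _ _ => Unit
  Ob := fun _ => Bool
  realify := id
  Strip := Unit
  IsoS := fun _ _ => Unit
  M := fun _ _ => Unit
  sig := boolSig
  split := { Msplit := fun _ _ => ⊤, exists_gen := fun _ _ => ⟨⟨(), trivial⟩, top_unit_isGenerator _⟩ }
  ObΔ := Bool
  N := fun _ _ => Unit
  qData := { q := fun _ _ => (), q_gen := fun _ _ => unit_isGenerator _, objOf := fun _ => true }
  frame := fun j vQ => gapFrame _
  hul_adm := fun _ _ _ _ => trivial
  thetaRegionOf := fun _ o _ _ => cond o Set.univ {0}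
  qRegionOf := fun o' _ _ => cond o' {0} Set.univ
  qRegion_mem := fun _ _ => Set.mem_insert _ _
  qSupport_finite := fun _ => Set.toFinite _

/-- The Θ-pilot object of the two-object setting is `true`. [folklore] -/
theorem two_thetaPilot : twoSetting.thetaPilot = true := rfl

/-- The `q`-pilot object of the two-object setting is `true`. [folklore] -/
theorem two_qPilot : twoSetting.qPilot = true := rfl

/-- The identity gluing `†𝒞^⊩_lgp → †𝒞^⊩_△` on objects (`true ↦ true` is (xi-a)). [folklore] -/
def idGluing : LinkGluing twoSetting := ⟨fun o => o, rfl⟩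

/-! ### The pilot: `−|log(Θ)| = −1 ≥ −2 = −|log(q)|` -/

/-- The (Ind3)-enlarged Θ-pilot region is the whole packet. [folklore] -/
theorem two_thetaRegion3 (j : toyIndex.Label) (vQ : toyIndex.VQ) :
    twoSetting.thetaRegion3 j vQ = Set.univ := by
  show (⋃ _ : ℤ, (Set.univ : Set (toyShells.Packet j vQ))) = Set.univ
  exact Set.iUnion_const _

/-- The union of the possible images of the Θ-pilot object is the whole packet. [folklore] -/
theorem two_sUnion_possibleImages (j : toyIndex.Label) (vQ : toyIndex.VQ) :
    ⋃₀ twoSetting.possibleImages j vQ = (Set.univ : Set (toyShells.Packet j vQ)) := by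
  refine Set.eq_univ_of_univ_subset (Set.subset_sUnion_of_mem ?_)
  exact two_thetaRegion3 j vQ ▸ twoSetting.thetaRegion3_mem_possibleImages j vQ

/-- The packet hull of the Θ-pilot object is the whole packet. [folklore] -/
theorem two_thetaHull (j : toyIndex.Label) (vQ : toyIndex.VQ) :
    twoSetting.thetaHull j vQ = (Set.univ : Set (toyShells.Packet j vQ)) :=
  Set.eq_univ_of_univ_subset (((two_sUnion_possibleImages j vQ).symm.le).trans
    ((gapFrame (toyShells.Packet j vQ)).subset_hull (⋃₀ twoSetting.possibleImages j vQ)))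

/-- The local Θ-volume of the pilot is `−1`. [folklore] -/
theorem two_thetaLocal (j : toyIndex.Label) (vQ : toyIndex.VQ) :
    twoSetting.thetaLocal j vQ = ((-1 : ℝ) : WithTop ℝ) := by
  unfold Cor312.Setting.thetaLocal
  rw [if_pos (show twoSetting.HullDefined j vQ from ⟨trivial, trivial⟩)]
  show ((gapData.logvol j vQ (twoSetting.thetaHull j vQ) : ℝ) : WithTop ℝ) = _
  rw [two_thetaHull, gapData_logvol_univ]

/-- The local `q`-volume of the pilot is `−2`. [folklore] -/
theorem two_qLocal (j : toyIndex.Label) (vQ : toyIndex.VQ) : twoSetting.qLocal j vQ = -2 :=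
  gapData_logvol_of_subset subset_rfl

/-- The two-object setting is `ThetaFinite`. [folklore] -/
theorem two_thetaFinite : twoSetting.ThetaFinite :=
  ⟨fun i vQ => by rw [two_thetaLocal]; exact WithTop.coe_ne_top, fun _ => Set.toFinite _⟩

/-- `−|log(Θ)| = −1` in the two-object setting. [folklore] -/
theorem two_negLogTheta : twoSetting.negLogTheta = ((-1 : ℝ) : WithTop ℝ) := by
  unfold Cor312.Setting.negLogTheta
  rw [if_pos two_thetaFinite]
  have h : ∀ i : Fin toyIndex.lstar,
      (∑ᶠ vQ : toyIndex.VQ, (twoSetting.thetaLocal (Cor312.Setting.labelSucc i) vQ).untopD 0) = -1 := by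
    intro i
    have h1 : (fun vQ : toyIndex.VQ =>
        (twoSetting.thetaLocal (Cor312.Setting.labelSucc i) vQ).untopD 0) = fun _ => (-1 : ℝ) := by
      funext vQ
      rw [two_thetaLocal, WithTop.untopD_coe]
    rw [h1, finsum_unique]
  simp only [h]
  exact congrArg _ (processionNormalized_const (by decide) (-1))

/-- `−|log(q)| = −2` in the two-object setting. [folklore] -/
theorem two_negLogQ : twoSetting.negLogQ = -2 := by
  unfold Cor312.Setting.negLogQ
  have h : ∀ i : Fin toyIndex.lstar,
      (∑ᶠ vQ : toyIndex.VQ, twoSetting.qLocal (Cor312.Setting.labelSucc i) vQ) = -2 := by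
    intro i
    have h1 : (fun vQ : toyIndex.VQ => twoSetting.qLocal (Cor312.Setting.labelSucc i) vQ) =
        fun _ => (-2 : ℝ) := by
      funext vQ
      exact two_qLocal _ vQ
    rw [h1, finsum_unique]
  simp only [h]
  exact processionNormalized_const (by decide) (-2)

/-- All bridge hypotheses hold in the two-object setting. [folklore] -/
theorem twoSetting_bridgeHyps : BridgeHyps twoSetting where
  mono := fun i vQ A B _ _ hAB => gapData_logvol_mono hAB
  image_adm := fun _ _ _ _ => trivial
  image_fin := fun _ => Set.toFinite _
  hul_nonempty := fun j vQ H hH => by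
    rcases hH with rfl | rfl
    · exact ⟨0, rfl⟩
    · exact ⟨0, Set.mem_univ 0⟩
  theta_nonempty := fun i vQ => by
    rw [two_thetaRegion3]
    exact ⟨0, Set.mem_univ 0⟩
  finite := two_thetaFinite

/-- "`|log(q)| > 0`" holds in the two-object setting. [folklore] -/
theorem twoSetting_absLogQPos : twoSetting.AbsLogQPos := by
  show twoSetting.negLogQ < 0
  rw [two_negLogQ]; norm_num

/-- The typed Corollary 3.12 HOLDS (strictly) in the two-object setting. [folklore] -/
theorem twoSetting_statement : twoSetting.Statement := by
  refine ⟨by rw [two_negLogTheta]; exact WithTop.coe_ne_top, ?_⟩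
  rw [two_negLogQ, two_negLogTheta, WithTop.coe_le_coe]
  norm_num

/-! ### The second object `false`: Θ-side volume `−2`, `q`-side volume `−1` — soundness FAILS there -/

/-- The (Ind3)-enlarged Kummer image of the object `false` is `{0}`. [folklore] -/
theorem two_thetaRegion3At_false (j : toyIndex.Label) (vQ : toyIndex.VQ) :
    thetaRegion3At twoSetting false j vQ = {0} := by
  show (⋃ _ : ℤ, ({0} : Set (toyShells.Packet j vQ))) = {0}
  exact Set.iUnion_const _

/-- The possible images of `false` are exactly `{0}`. [folklore] -/
theorem two_mem_possibleImagesAt_false_iff (j : toyIndex.Label) (vQ : toyIndex.VQ)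
    (U : Set (toyShells.Packet j vQ)) :
    U ∈ possibleImagesAt twoSetting false j vQ ↔ U = {0} := by
  constructor
  · rintro ⟨Φ, -, rfl⟩
    rw [two_thetaRegion3At_false, Set.image_singleton, map_zero]
    rfl
  · rintro rfl
    exact ⟨1, (Cor312.Setting.indGroup gapSituation).one_mem, by
      rw [two_thetaRegion3At_false, Set.image_singleton]; rfl⟩

/-- The union of the possible images of `false` is `{0}`. [folklore] -/
theorem two_sUnion_possibleImagesAt_false (j : toyIndex.Label) (vQ : toyIndex.VQ) :
    ⋃₀ possibleImagesAt twoSetting false j vQ = ({0} : Set (toyShells.Packet j vQ)) := by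
  ext x
  simp only [Set.mem_sUnion]
  constructor
  · rintro ⟨U, hU, hx⟩
    rwa [(two_mem_possibleImagesAt_false_iff j vQ U).1 hU] at hx
  · intro hx
    exact ⟨{0}, (two_mem_possibleImagesAt_false_iff j vQ _).2 rfl, hx⟩

/-- The packet hull of `false` is `{0}`. [folklore] -/
theorem two_thetaHullAt_false (j : toyIndex.Label) (vQ : toyIndex.VQ) :
    thetaHullAt twoSetting false j vQ = ({0} : Set (toyShells.Packet j vQ)) := by
  refine Set.Subset.antisymm ?_ ?_
  · show (gapFrame _).hull (⋃₀ possibleImagesAt twoSetting false j vQ) ⊆ {0}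
    exact gapFrame_hull_of_subset (two_sUnion_possibleImagesAt_false j vQ).le
  · exact ((two_sUnion_possibleImagesAt_false j vQ).symm.le).trans
      ((gapFrame (toyShells.Packet j vQ)).subset_hull (⋃₀ possibleImagesAt twoSetting false j vQ))

/-- The local Θ-volume of `false` is `−2`. [folklore] -/
theorem two_thetaLocalAt_false (j : toyIndex.Label) (vQ : toyIndex.VQ) :
    thetaLocalAt twoSetting false j vQ = ((-2 : ℝ) : WithTop ℝ) := by
  unfold thetaLocalAt
  rw [if_pos (show HullDefinedAt twoSetting false j vQ from ⟨trivial, trivial⟩)]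
  show ((gapData.logvol j vQ (thetaHullAt twoSetting false j vQ) : ℝ) : WithTop ℝ) = _
  rw [two_thetaHullAt_false, gapData_logvol_of_subset subset_rfl]

/-- `false` is `ThetaFiniteAt`. [folklore] -/
theorem two_thetaFiniteAt_false : ThetaFiniteAt twoSetting false :=
  ⟨fun i vQ => by rw [two_thetaLocalAt_false]; exact WithTop.coe_ne_top, fun _ => Set.toFinite _⟩

/-- The global Θ-side volume of the input `false` is `−2`. [folklore] -/
theorem two_negLogThetaAt_false : negLogThetaAt twoSetting false = ((-2 : ℝ) : WithTop ℝ) := by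
  unfold negLogThetaAt
  rw [if_pos two_thetaFiniteAt_false]
  have h : ∀ i : Fin toyIndex.lstar,
      (∑ᶠ vQ : toyIndex.VQ,
        (thetaLocalAt twoSetting false (Cor312.Setting.labelSucc i) vQ).untopD 0) = -2 := by
    intro i
    have h1 : (fun vQ : toyIndex.VQ =>
        (thetaLocalAt twoSetting false (Cor312.Setting.labelSucc i) vQ).untopD 0) =
        fun _ => (-2 : ℝ) := by
      funext vQ
      rw [two_thetaLocalAt_false, WithTop.untopD_coe]
    rw [h1, finsum_unique]
  simp only [h]
  exact congrArg _ (processionNormalized_const (by decide) (-2))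

/-- The global `q`-side volume of the object `false` of `†𝒞^⊩_△` is `−1`. [folklore] -/
theorem two_negLogQAt_false : negLogQAt twoSetting false = -1 := by
  unfold negLogQAt
  have h : ∀ i : Fin toyIndex.lstar,
      (∑ᶠ vQ : toyIndex.VQ, qLocalAt twoSetting false (Cor312.Setting.labelSucc i) vQ) = -1 := by
    intro i
    have h1 : (fun vQ : toyIndex.VQ => qLocalAt twoSetting false (Cor312.Setting.labelSucc i) vQ) =
        fun _ => (-1 : ℝ) := by
      funext vQ
      exact gapData_logvol_univ _ vQ
    rw [h1, finsum_unique]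
  simp only [h]
  exact processionNormalized_const (by decide) (-1)

/-- **GapA FAILS in the two-object setting for the identity gluing** — at the non-pilot input `false`
(`−|log q|`-side `−1 > −2 = Θ`-side) — although the typed Corollary 3.12 HOLDS there. [folklore] -/
theorem twoSetting_not_soundAtInput : ¬ SoundAtInput twoSetting idGluing := by
  intro h
  obtain ⟨-, hle⟩ := h false
  rw [two_negLogThetaAt_false, show idGluing.linkMap false = false from rfl, two_negLogQAt_false,
    WithTop.coe_le_coe] at hle
  norm_num at hle

/-- **GapA IS STRICTLY STRONGER THAN THE TYPED COROLLARY over the frozen interfaces**: there is an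
instantiation where the typed Theorem 3.11 holds in full, every bridge hypothesis and `|log(q)| > 0` hold,
the typed Corollary 3.12 HOLDS — and GapA (`SoundAtInput`, for the exhibited gluing) FAILS. So the (G)
derivation "GapA ⟹ Statement" consumes a hypothesis that is not implied back by its conclusion (plus the
premises): the universal quantifier over the algorithm's inputs is genuine extra content as soon as
`†𝒞^⊩_lgp` has a second object. Interface-level; no side taken. [folklore] -/
theorem statement_not_imp_soundAtInput :
    ∃ (T : ThetaIndex) (F : FullSituation T) (P : Cor312.Setting F.toLatticeSituation.toSituation)
      (G : LinkGluing P),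
      F.Statement ∧ BridgeHyps P ∧ P.AbsLogQPos ∧ P.Statement ∧ ¬ SoundAtInput P G :=
  ⟨toyIndex, gapFull, twoSetting, idGluing, gapFull_statement, twoSetting_bridgeHyps,
    twoSetting_absLogQPos, twoSetting_statement, twoSetting_not_soundAtInput⟩

end TwoObjectWitness

end Cor312Vol

end IUTFork

end Summit.ABC

end
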